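import Literature.Computability.ImplicitComplexity.SoftTypeAssignmentClosed
import Literature.Computability.ImplicitComplexity.SoftTypeAssignmentLmoRename
import HarnessLib

/-!
# Head rounds: leftmost evaluation of iterated (sums of) pass combinators

The control skeleton of the NP-completeness half of `STAPlusCapturesNP` (GMR08 =
Gaboardi–Marion–Ronchi Della Rocca 2008, Thm. 5.14: a nondeterministic machine is programmed by
ITERATING THE SUM `Tr₁ + ⋯ + Trₙ` of deterministic transition terms). After the numerals are
unfolded, such a program has the shape `(C (C (⋯ (S (S (⋯ X)))))) a₁ a₂ a⃗` where `C` and the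
summands of `S` are *pass combinators* `λr.λc.λz. r (S' c) (I z) F` (one fold over the previous
configuration). Its leftmost-outermost evaluation — which finds the answer `0` whenever some
reduction does (`reduces_zero_iff_lmoStar`) — is forced: each round is three head `β`-steps,
preceded, for a sum at the head, by the choice of a summand (`HeadSum.lmoStar_zero`). Hence
(`choice_rounds_zero`): the program reaches `0` iff for SOME sequence of summands the resolved,
explicitly computed spine `X (⋯)` does; and the same rounds are available as reductions
(`lmoStar_choice_rounds`).

* `HeadBeta`, `HBStar` — head `β`-steps (deterministic for `Lmo`), `hbStar_apps_lams`;
* `HeadSum` — a sum in head position: leftmost steps are exactly the two choices;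
* `passC S I F`, `PassC.round`, `det_rounds`, `sums`, `choice_rounds_zero`.

## References

* [GaboardiMarionRonchidellarocca2008] Thm. 5.14 (proof: iteration of `Tr₁ + ⋯ + Trₙ`), Def. 5.2, Table 6.
-/

namespace Literature.Computability.ImplicitComplexity

namespace STA

open Term

/-! ### Head `β`-steps are forced for the leftmost strategy -/

/-- A `β`-redex in weak head position: `(λP)N A₁ ⋯ A_k → P[N/x] A₁ ⋯ A_k`. [folklore] -/
inductive HeadBeta : Term → Term → Prop
  | here (P N : Term) : HeadBeta (.app (.lam P) N) (P.subst0 N)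
  | app {M M' : Term} (A : Term) (h : HeadBeta M M') : HeadBeta (.app M A) (.app M' A)

namespace HeadBeta

/-- A head `β`-step is a weak head step. [folklore] -/
theorem hd {M M' : Term} (h : HeadBeta M M') : Hd M M' := by
  induction h with
  | here P N => exact Hd.beta P N
  | app A _ ih => exact Hd.appL A ih

/-- … hence a leftmost step and a reduction step. [folklore] -/
theorem lmo {M M' : Term} (h : HeadBeta M M') : Lmo M M' := Lmo.hd h.hd

/-- A head `β`-step is a `β`-step. [folklore] -/
theorem redB {M M' : Term} (h : HeadBeta M M') : RedB M M' := by
  induction h with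
  | here P N => exact RedB.beta P N
  | app A _ ih => exact RedB.appL A ih

/-- The subject of a head `β`-step is an application. [folklore] -/
theorem exists_app {M M' : Term} (h : HeadBeta M M') : ∃ A B, M = .app A B := by
  cases h with
  | here P N => exact ⟨_, _, rfl⟩
  | app A h => exact ⟨_, _, rfl⟩

/-- Lifting through a spine. [folklore] -/
theorem apps {M M' : Term} (h : HeadBeta M M') (as : List Term) : HeadBeta (M.apps as) (M'.apps as) := by
  induction as generalizing M M' with
  | nil => exact h
  | cons a as ih => exact ih (HeadBeta.app a h)

/-- **Determinism**: the leftmost step from a term with a head `β`-redex is that `β`-step.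
[folklore] -/
theorem lmo_unique {M M' X : Term} (h : HeadBeta M M') (hX : Lmo M X) : X = M' := by
  induction h generalizing X with
  | here P N =>
    cases hX with
    | hd h =>
      cases h with
      | beta => rfl
      | appL _ h => cases h
    | appL _ hne _ => cases hne
    | appR hne _ _ => cases hne
  | app A h ih =>
    obtain ⟨A₀, B₀, rfl⟩ := h.exists_app
    cases hX with
    | hd h' =>
      cases h' with
      | appL _ h' => rw [ih (Lmo.hd h')]
    | appL _ _ h' => rw [ih h']
    | appR _ hn _ => exact absurd h.hd.red (hn _)

/-- The term after a head `β`-step still reaches `0` by leftmost steps if the term before did.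
[folklore] -/
theorem lmoStar_zero {M M' : Term} (h : HeadBeta M M') (hz : LmoStar M zero) : LmoStar M' zero := by
  rcases Relation.ReflTransGen.cases_head hz with e | ⟨X, hX, hXz⟩
  · obtain ⟨A, B, rfl⟩ := h.exists_app
    cases e
  · rwa [h.lmo_unique hX] at hXz

end HeadBeta

/-- Finitely many head `β`-steps. [folklore] -/
def HBStar : Term → Term → Prop := Relation.ReflTransGen HeadBeta

namespace HBStar

/-- Head `β`-steps are leftmost steps. [folklore] -/
theorem lmoStar {M N : Term} (h : HBStar M N) : LmoStar M N := by
  induction h with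
  | refl => exact Relation.ReflTransGen.refl
  | tail _ hst ih => exact Relation.ReflTransGen.tail ih hst.lmo

/-- Head `β`-steps are reductions. [folklore] -/
theorem reduces {M N : Term} (h : HBStar M N) : Reduces M N := h.lmoStar.reduces

/-- Head `β`-steps are `β`-reductions. [folklore] -/
theorem betaReduces {M N : Term} (h : HBStar M N) : BetaReduces M N := by
  induction h with
  | refl => exact Relation.ReflTransGen.refl
  | tail _ hst ih => exact ih.tail hst.redB

/-- **Reaching `0` is decided after the forced head `β`-steps.** [folklore] -/
theorem lmoStar_zero_iff {M N : Term} (h : HBStar M N) : LmoStar M zero ↔ LmoStar N zero := by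
  refine ⟨fun hz => ?_, fun hz => h.lmoStar.trans hz⟩
  induction h with
  | refl => exact hz
  | tail _ hst ih => exact hst.lmoStar_zero ih

/-- Lifting through a spine. [folklore] -/
theorem apps {M N : Term} (h : HBStar M N) (as : List Term) : HBStar (M.apps as) (N.apps as) := by
  induction h with
  | refl => exact Relation.ReflTransGen.refl
  | tail _ hst ih => exact Relation.ReflTransGen.tail ih (hst.apps as)

end HBStar

/-- Head `β`-step of a combinator applied to a closed argument. [folklore] -/
theorem headBeta_apps_lams {t : Term} (ht : t.Closed) (q : ℕ) (B : Term) (as : List Term) :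
    HeadBeta ((lams (q + 1) B).apps (t :: as)) ((lams q (B.substp (substAt q t))).apps as) := by
  rw [lams_succ, apps_cons, ← lams_subst0 ht]
  exact (HeadBeta.here _ _).apps as

/-- **`(λ^q B) t₀ ⋯ t_{q-1} a⃗` head-reduces to `B[t⃗] a⃗`** for closed `tᵢ`. [folklore] -/
theorem hbStar_apps_lams (B : Term) :
    ∀ (q : ℕ) (ts : List Term), ts.length = q → (∀ t ∈ ts, t.Closed) → ∀ as : List Term,
      HBStar ((lams q B).apps (ts ++ as)) ((B.substp (instN q ts)).apps as)
  | 0, [], _, _, as => by rw [instN_zero, substp_var]; exact Relation.ReflTransGen.refl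
  | 0, _ :: _, h, _, _ => absurd h (by simp)
  | _ + 1, [], h, _, _ => absurd h (by simp)
  | q + 1, t :: ts, hlen, hcl, as => by
    have ht : t.Closed := hcl t (by simp)
    rw [List.cons_append]
    refine Relation.ReflTransGen.head (headBeta_apps_lams ht q B (ts ++ as)) ?_
    have := hbStar_apps_lams (B.substp (substAt q t)) q ts (by simpa using hlen)
      (fun t' ht' => hcl t' (by simp [ht'])) as
    rwa [substp_substp, substp_congr (fun i => substAt_substp_instN ht i)] at this

/-! ### A sum in head position -/

/-- `HeadSum M L R`: `M = (A + B) N₁ ⋯ N_k` with `L = A N⃗`, `R = B N⃗`. [folklore] -/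
inductive HeadSum : Term → Term → Term → Prop
  | here (A B : Term) : HeadSum (.sum A B) A B
  | app {M L R : Term} (N : Term) (h : HeadSum M L R) : HeadSum (.app M N) (.app L N) (.app R N)

namespace HeadSum

/-- The left choice is a leftmost step. [folklore] -/
theorem lmo_left {M L R : Term} (h : HeadSum M L R) : Lmo M L := by
  refine Lmo.hd ?_
  induction h with
  | here A B => exact Hd.choiceL A B
  | app N _ ih => exact Hd.appL N ih

/-- The right choice is a leftmost step. [folklore] -/
theorem lmo_right {M L R : Term} (h : HeadSum M L R) : Lmo M R := by
  refine Lmo.hd ?_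
  induction h with
  | here A B => exact Hd.choiceR A B
  | app N _ ih => exact Hd.appL N ih

/-- Lifting through a spine. [folklore] -/
theorem apps {M L R : Term} (h : HeadSum M L R) (as : List Term) : HeadSum (M.apps as) (L.apps as) (R.apps as) := by
  induction as generalizing M L R with
  | nil => exact h
  | cons a as ih => exact ih (HeadSum.app a h)

/-- **The leftmost steps from a term with a head sum are exactly the two choices.** [folklore] -/
theorem lmo_cases {M L R X : Term} (h : HeadSum M L R) (hX : Lmo M X) : X = L ∨ X = R := by
  induction h generalizing X with
  | here A B => exact Lmo.sum_inv hX
  | @app M L R N h ih =>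
    have hshape : (∃ A B, M = Term.sum A B) ∨ (∃ A B, M = Term.app A B) := by
      cases h with
      | here A B => exact Or.inl ⟨_, _, rfl⟩
      | app N h => exact Or.inr ⟨_, _, rfl⟩
    cases hX with
    | hd h' =>
      cases h' with
      | beta P N' => rcases hshape with ⟨A, B, e⟩ | ⟨A, B, e⟩ <;> cases e
      | appL _ h' =>
        rcases ih (Lmo.hd h') with rfl | rfl
        · exact Or.inl rfl
        · exact Or.inr rfl
    | appL _ _ h' =>
      rcases ih h' with rfl | rfl
      · exact Or.inl rfl
      · exact Or.inr rfl
    | appR _ hn _ => exact absurd h.lmo_left.red (hn _)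

/-- The term with a head sum reaches `0` by leftmost steps only through one of the choices.
[folklore] -/
theorem lmoStar_zero {M L R : Term} (h : HeadSum M L R) (hz : LmoStar M zero) : LmoStar L zero ∨ LmoStar R zero := by
  rcases Relation.ReflTransGen.cases_head hz with e | ⟨X, hX, hXz⟩
  · subst e; cases h
  · rcases h.lmo_cases hX with rfl | rfl
    · exact Or.inl hXz
    · exact Or.inr hXz

end HeadSum

/-- Right-nested sum `C₁ + (C₂ + (⋯ + C_k))` of a nonempty list (`0` for the empty list, unused).
[cite: GaboardiMarionRonchidellarocca2008, Thm. 5.14 (`Tr₁ + ⋯ + Trₙ`)] -/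
def sums : List Term → Term
  | [] => zero
  | [C] => C
  | C :: C' :: Cs => .sum C (sums (C' :: Cs))

/-- A sum of closed terms is closed. [folklore] -/
theorem closed_sums {Cs : List Term} (h : ∀ C ∈ Cs, C.Closed) : (sums Cs).Closed := by
  induction Cs with
  | nil => exact closed_zero
  | cons C Cs ih =>
    cases Cs with
    | nil => exact h C (by simp)
    | cons C' Cs =>
      rw [sums, closed_sum]
      exact ⟨h C (by simp), ih fun D hD => h D (by simp [hD])⟩

/-- Every summand is reached by leftmost choices. [folklore] -/
theorem lmoStar_sums_apps {Cs : List Term} {C : Term} (hC : C ∈ Cs) (as : List Term) :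
    LmoStar ((sums Cs).apps as) (C.apps as) := by
  induction Cs with
  | nil => cases hC
  | cons D Cs ih =>
    cases Cs with
    | nil =>
      rw [List.mem_singleton] at hC; subst hC
      exact Relation.ReflTransGen.refl
    | cons D' Cs =>
      have hs : HeadSum ((sums (D :: D' :: Cs)).apps as) (D.apps as) ((sums (D' :: Cs)).apps as) :=
        (HeadSum.here _ _).apps as
      rcases List.mem_cons.1 hC with rfl | hC
      · exact Relation.ReflTransGen.single hs.lmo_left
      · exact Relation.ReflTransGen.head hs.lmo_right (ih hC)

/-- **Reaching `0` from a head sum goes through one of the summands.** [folklore] -/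
theorem sums_apps_lmoStar_zero {Cs : List Term} (hne : Cs ≠ []) {as : List Term}
    (hz : LmoStar ((sums Cs).apps as) zero) : ∃ C ∈ Cs, LmoStar (C.apps as) zero := by
  induction Cs with
  | nil => exact absurd rfl hne
  | cons D Cs ih =>
    cases Cs with
    | nil => exact ⟨D, by simp, hz⟩
    | cons D' Cs =>
      have hs : HeadSum ((sums (D :: D' :: Cs)).apps as) (D.apps as) ((sums (D' :: Cs)).apps as) :=
        (HeadSum.here _ _).apps as
      rcases hs.lmoStar_zero hz with h | h
      · exact ⟨D, by simp, h⟩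
      · obtain ⟨C, hC, hCz⟩ := ih (by simp) h
        exact ⟨C, by simp [hC], hCz⟩

/-! ### Pass combinators and rounds -/

/-- The pass combinator `λr.λc.λz. r (S c) (I z) F`: fold the previous configuration `r` with the
step `S c` from the initial state `I z` and finish with `F` (one deterministic transition `Trᵢ`
of GMR08 as a program on Church-encoded configurations). [cite: GaboardiMarionRonchidellarocca2008, Thm. 5.14 (proof)] -/
def passC (S I F : Term) : Term := lams 3 ((Term.var 2).apps [S.app (.var 1), I.app (.var 0), F])

/-- A bundled pass combinator with closed components. [folklore] -/
structure PassC where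
  /-- the step (applied to the output constructor `c`) -/
  S : Term
  /-- the initial state (applied to the output end `z`) -/
  I : Term
  /-- the finishing projection -/
  F : Term
  hS : S.Closed
  hI : I.Closed
  hF : F.Closed

namespace PassC

/-- The term of a bundled pass combinator. [folklore] -/
def term (c : PassC) : Term := passC c.S c.I c.F

/-- Pass combinators are closed. [folklore] -/
theorem closed_term (c : PassC) : c.term.Closed := by
  simp only [term, passC, Closed, bnd_lams, Nat.zero_add]
  exact bnd_apps (by decide) (by simp [c.hS.bnd, c.hI.bnd, c.hF.bnd])

/-- The effect of one round on the argument spine: `a₁ a₂ a⃗ ↦ (S a₁) (I a₂) F a⃗`. [folklore] -/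
def φ (c : PassC) : List Term → List Term
  | a₁ :: a₂ :: rest => c.S.app a₁ :: c.I.app a₂ :: c.F :: rest
  | l => l

/-- **One round**: `(passC S I F) R a₁ a₂ a⃗` head-reduces to `R (S a₁) (I a₂) F a⃗`. [folklore] -/
theorem round (c : PassC) {R a₁ a₂ : Term} (hR : R.Closed) (h₁ : a₁.Closed) (h₂ : a₂.Closed) (rest : List Term) :
    HBStar ((c.term.app R).apps (a₁ :: a₂ :: rest)) (R.apps (c.φ (a₁ :: a₂ :: rest))) := by
  have := hbStar_apps_lams ((Term.var 2).apps [c.S.app (.var 1), c.I.app (.var 0), c.F]) 3 [R, a₁, a₂] rfl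
    (by simp [hR, h₁, h₂]) rest
  simp only [substp_apps, List.map_cons, List.map_nil, Term.substp, instN, List.getD, c.hS.substp_eq,
    c.hI.substp_eq, c.hF.substp_eq] at this
  exact this

end PassC

/-- `C₁ (C₂ (⋯ (C_k X)))`. [folklore] -/
def nestApp : List Term → Term → Term
  | [], X => X
  | C :: Cs, X => C.app (nestApp Cs X)

/-- Nested applications of closed terms are closed. [folklore] -/
theorem closed_nestApp {Cs : List Term} (h : ∀ C ∈ Cs, C.Closed) {X : Term} (hX : X.Closed) : (nestApp Cs X).Closed := by
  induction Cs with
  | nil => exact hX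
  | cons C Cs ih => exact closed_app.2 ⟨h C (by simp), ih fun D hD => h D (by simp [hD])⟩

/-- `F (F (⋯ (F X)))`, `P` times: the unfolded iteration `P̲ F X`. [folklore] -/
theorem nestApp_replicate (F : Term) (P : ℕ) (X : Term) : nestApp (List.replicate P F) X = (fun t => F.app t)^[P] X := by
  induction P with
  | zero => rfl
  | succ P ih => rw [List.replicate_succ, nestApp, ih, Function.iterate_succ_apply']

/-- The argument spine after the rounds of a list of pass combinators (outermost first). [folklore] -/
def rounds : List PassC → List Term → List Term
  | [], args => args
  | c :: cs, args => rounds cs (c.φ args)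

/-- Shape invariant of the argument spine: at least two arguments, all closed. [folklore] -/
def GoodArgs (args : List Term) : Prop := 2 ≤ args.length ∧ ∀ a ∈ args, a.Closed

/-- One round preserves the shape invariant. [folklore] -/
theorem GoodArgs.φ {args : List Term} (h : GoodArgs args) (c : PassC) : GoodArgs (c.φ args) := by
  obtain ⟨hlen, hcl⟩ := h
  match args, hlen, hcl with
  | a₁ :: a₂ :: rest, _, hcl =>
    refine ⟨by simp [PassC.φ], ?_⟩
    intro a ha
    simp only [PassC.φ, List.mem_cons] at ha
    rcases ha with rfl | rfl | rfl | ha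
    · exact closed_app.2 ⟨c.hS, hcl _ (by simp)⟩
    · exact closed_app.2 ⟨c.hI, hcl _ (by simp)⟩
    · exact c.hF
    · exact hcl a (by simp [ha])

/-- Rounds preserve the shape invariant. [folklore] -/
theorem GoodArgs.rounds {args : List Term} (h : GoodArgs args) : ∀ cs : List PassC, GoodArgs (rounds cs args)
  | [] => h
  | c :: cs => (h.φ c).rounds cs

/-- **Deterministic rounds**: `C₁ (C₂ (⋯ (C_k X))) a⃗` head-reduces to `X (rounds [C₁,…,C_k] a⃗)`.
[folklore] -/
theorem det_rounds : ∀ (cs : List PassC) {X : Term}, X.Closed → ∀ {args : List Term}, GoodArgs args →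
    HBStar ((nestApp (cs.map PassC.term) X).apps args) (X.apps (rounds cs args))
  | [], _, _, _, _ => Relation.ReflTransGen.refl
  | c :: cs, X, hX, args, hargs => by
    obtain ⟨hlen, hcl⟩ := hargs
    match args, hlen, hcl with
    | a₁ :: a₂ :: rest, _, hcl =>
      have hR : (nestApp (cs.map PassC.term) X).Closed :=
        closed_nestApp (fun C hC => by obtain ⟨c', -, rfl⟩ := List.mem_map.1 hC; exact c'.closed_term) hX
      refine (c.round hR (hcl a₁ (by simp)) (hcl a₂ (by simp)) rest).trans ?_
      have hg : GoodArgs (a₁ :: a₂ :: rest) := ⟨by simp, hcl⟩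
      exact det_rounds cs hX (hg.φ c)

/-- **Choice rounds, existence**: iterating the sum of the pass combinators `cs` `P` times over
`X`, every sequence of `P` summands is realised by leftmost steps. [cite: GaboardiMarionRonchidellarocca2008, Thm. 5.14 (proof)] -/
theorem lmoStar_choice_rounds (cs : List PassC) {X : Term} (hX : X.Closed) :
    ∀ (σs : List (Fin cs.length)) {args : List Term}, GoodArgs args →
      LmoStar ((nestApp (List.replicate σs.length (sums (cs.map PassC.term))) X).apps args)
        (X.apps (rounds (σs.map cs.get) args))
  | [], _, _ => Relation.ReflTransGen.refl
  | σ :: σs, args, hargs => by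
    obtain ⟨hlen, hcl⟩ := hargs
    match args, hlen, hcl with
    | a₁ :: a₂ :: rest, _, hcl =>
      rw [List.length_cons, List.replicate_succ, nestApp, List.map_cons, rounds]
      set R := nestApp (List.replicate σs.length (sums (cs.map PassC.term))) X with hRdef
      have hR : R.Closed := closed_nestApp (fun C hC => by
        rw [List.eq_of_mem_replicate hC]
        exact closed_sums fun D hD => by obtain ⟨c', -, rfl⟩ := List.mem_map.1 hD; exact c'.closed_term) hX
      have hmem : (cs.get σ).term ∈ cs.map PassC.term := List.mem_map.2 ⟨_, List.get_mem cs σ, rfl⟩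
      have h1 : LmoStar (((sums (cs.map PassC.term)).app R).apps (a₁ :: a₂ :: rest))
          (((cs.get σ).term.app R).apps (a₁ :: a₂ :: rest)) := by
        have := lmoStar_sums_apps hmem (R :: a₁ :: a₂ :: rest)
        simpa using this
      refine h1.trans (((cs.get σ).round hR (hcl a₁ (by simp)) (hcl a₂ (by simp)) rest).lmoStar.trans ?_)
      have hg : GoodArgs (a₁ :: a₂ :: rest) := ⟨by simp, hcl⟩
      exact lmoStar_choice_rounds cs hX σs (hg.φ (cs.get σ))

/-- **Choice rounds, analysis**: if the `P`-fold iteration of the sum of the pass combinators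
reaches `0` by leftmost steps, then so does the resolved spine of SOME sequence of `P` summands.
[cite: GaboardiMarionRonchidellarocca2008, Thm. 5.14 (proof)] -/
theorem choice_rounds_zero (cs : List PassC) (hne : cs ≠ []) {X : Term} (hX : X.Closed) :
    ∀ (P : ℕ) {args : List Term}, GoodArgs args →
      LmoStar ((nestApp (List.replicate P (sums (cs.map PassC.term))) X).apps args) zero →
      ∃ σs : List (Fin cs.length), σs.length = P ∧ LmoStar (X.apps (rounds (σs.map cs.get) args)) zero
  | 0, _, _, hz => ⟨[], rfl, hz⟩
  | P + 1, args, hargs, hz => by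
    obtain ⟨hlen, hcl⟩ := hargs
    match args, hlen, hcl, hz with
    | a₁ :: a₂ :: rest, _, hcl, hz =>
      rw [List.replicate_succ, nestApp] at hz
      set R := nestApp (List.replicate P (sums (cs.map PassC.term))) X with hRdef
      have hR : R.Closed := closed_nestApp (fun C hC => by
        rw [List.eq_of_mem_replicate hC]
        exact closed_sums fun D hD => by obtain ⟨c', -, rfl⟩ := List.mem_map.1 hD; exact c'.closed_term) hX
      have hz' : LmoStar ((sums (cs.map PassC.term)).apps (R :: a₁ :: a₂ :: rest)) zero := by simpa using hz
      obtain ⟨C, hC, hCz⟩ := sums_apps_lmoStar_zero (by simpa using hne) hz'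
      obtain ⟨σ, rfl⟩ : ∃ σ : Fin cs.length, C = (cs.get σ).term := by
        obtain ⟨c', hc', rfl⟩ := List.mem_map.1 hC
        obtain ⟨σ, rfl⟩ := List.mem_iff_get.1 hc'
        exact ⟨σ, rfl⟩
      have hround := (cs.get σ).round hR (hcl a₁ (by simp)) (hcl a₂ (by simp)) rest
      have hz2 : LmoStar (R.apps ((cs.get σ).φ (a₁ :: a₂ :: rest))) zero :=
        (hround.lmoStar_zero_iff).1 (by simpa using hCz)
      have hg : GoodArgs (a₁ :: a₂ :: rest) := ⟨by simp, hcl⟩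
      obtain ⟨σs, hσs, hfin⟩ := choice_rounds_zero cs hne hX P (hg.φ (cs.get σ)) hz2
      exact ⟨σ :: σs, by simp [hσs], by simpa [rounds] using hfin⟩

/-- **Deterministic rounds decide**: `C₁ (⋯ (C_k X)) a⃗` reaches `0` by leftmost steps iff the
resolved spine does. [folklore] -/
theorem det_rounds_zero_iff (cs : List PassC) {X : Term} (hX : X.Closed) {args : List Term} (hargs : GoodArgs args) :
    LmoStar ((nestApp (cs.map PassC.term) X).apps args) zero ↔ LmoStar (X.apps (rounds cs args)) zero :=
  (det_rounds cs hX hargs).lmoStar_zero_iff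

end STA

end Literature.Computability.ImplicitComplexity
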